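import Literature.NumberTheory.EllipticCurves.TwoIsogenySelmerGroupRankProofs
import Literature.NumberTheory.EllipticCurves.BinaryQuarticGoodReductionSolubilityProofs
import Literature.NumberTheory.DiophantineGeometry.LindMordellQuarticsHassePrincipleFailure
import Literature.NumberTheory.QuadraticForms.PadicSquares
import Literature.NumberTheory.EllipticCurves.Curve346SelmerCertificatesA
import Mathlib.Tactic.Simproc.Factors
import HarnessLib

/-!
# `7` explicit everywhere-locally-soluble classes of the `2`-isogeny Selmer group `S(-230, -2400)` of
# `M₁₀ : y² = x³ -230x² -2400x` — the homogeneous spaces `w² = d u⁴ -230 u²z² + (-2400/d) z⁴`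
# (three of them with a rational point, four without: the latter carry `Ш(V₀/ℚ)[φ] ≅ ℤ/2`, see `Curve2000HiddenClassCount`)

Topic `NumberTheory/EllipticCurves`. Third file of the cell `Curve2000*` (`Curve2000SharpDescent`, `Curve2000IsogenyChain`, this,
`Curve2000HiddenClassCount`). `S(-230, -2400)` (the Selmer group `S^{(φ̂)}` of the pair `V₀ → M₁₀ = [0, -230, 0, -2400, 0]`, receiving
`α(M₁₀(ℚ))`) has at most `2^{ω(-2400)+1} = 16` classes; the classes `1, −6, −10, 15` are the images of the rational `2`-torsion
points of `M₁₀`. Here the `7` classes `d ∈ {-1, 6, 10, -15, -6, -10, 15}` are shown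
everywhere locally soluble by EXPLICIT LOCAL POINTS: a real point; a `ℚ₂`-point (a value `4^m·c`, `c ≡ 1 (mod 8)`, tree
`padicInt_isSquare_of_toZModPow_three_eq_one`); `ℚ_q`-points at the odd primes `q ∣ Δ = 2 ^ 13 * 3 * 5 ^ 14` (values `q^{2m}·c`,
`c` a non-zero square mod `q`, tree `exists_sq_eq_intCast`); good reduction elsewhere (tree
`BinaryQuartic.isSoluble_padic_of_not_dvd_disc`, Bhargava–Shankar Prop. 5.13). With the class `1` this gives `8` members; the other
`8` divisor classes die modulo `25`/`125` (`Curve2000HiddenClassCount`), so `dim₂ S(-230, -2400) = 3` exactly.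

Everything is re-verified by the kernel (the local points were found by a plain search). Theorems only.

## References

* [SilvermanAEC2009] J. H. Silverman, *AEC*, 2nd ed.: Prop. X.4.9, proof of Prop. X.6.2(b), Prop. X.6.5(a).
* [BhargavaShankarAnnals2015] M. Bhargava, A. Shankar, Ann. of Math. 181 (2015), Prop. 5.13.
-/

noncomputable section

open scoped Classical

namespace Literature.NumberTheory.EllipticCurves

namespace Curve2000

open Literature.NumberTheory.DiophantineGeometry.LindMordellQuartics (exists_sq_eq_intCast)
open Literature.NumberTheory.QuadraticForms (padicInt_isSquare_of_toZModPow_three_eq_one)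

/-! ## Local-point helpers for the quartics `⟨d, 0, -230, 0, e⟩` -/

/-- `Δ(⟨d, 0, -230, 0, e⟩) = 16·de·(-230² − 4de)² = -150000000000000` for `de = -2400`. [cite: BhargavaShankarAnnals2015, §1.2 (discriminant formula)] -/
theorem disc_C (d e : ℤ) (hde : d * e = -2400) : (twoIsogenyQuartic (-230) d e).disc = -150000000000000 := by
  simp only [twoIsogenyQuartic, BinaryQuartic.disc]
  linear_combination (256 * ((d * e) ^ 2 + -2400 * (d * e) + 5760000) - 128 * 52900 * (d * e + -2400) + 16 * 2798410000) * hde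

/-- A prime dividing `-150000000000000 = 2 ^ 13 * 3 * 5 ^ 14` is one of `[2, 3, 5]` (the primes of bad reduction of the quartics).
[cite: BhargavaShankarAnnals2015, Prop. 5.13 (the primes p ∣ Δ(f))] -/
theorem prime_dvd_disc_cases {p : ℕ} (hp : p.Prime) (h : (p : ℤ) ∣ -150000000000000) : p = 2 ∨ p = 3 ∨ p = 5 := by
  have h0 : p ∣ 2 ^ 13 * 3 * 5 ^ 14 := by
    have h2 : (p : ℤ) ∣ ((2 ^ 13 * 3 * 5 ^ 14 : ℕ) : ℤ) := by
      have h3 := Int.dvd_neg.mp h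
      norm_num at h3 ⊢
      exact h3
    exact_mod_cast h2
  rcases (Nat.Prime.dvd_mul hp).mp h0 with h0l | hr
  swap
  · exact Or.inr (Or.inr (((Nat.prime_dvd_prime_iff_eq hp (by norm_num : Nat.Prime 5)).mp (hp.dvd_of_dvd_pow hr))))
  rcases (Nat.Prime.dvd_mul hp).mp h0l with h0ll | hr
  swap
  · exact Or.inr (Or.inl ((Nat.prime_dvd_prime_iff_eq hp (by norm_num : Nat.Prime 3)).mp hr))
  exact Or.inl ((Nat.prime_dvd_prime_iff_eq hp (by norm_num : Nat.Prime 2)).mp (hp.dvd_of_dvd_pow h0ll))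

/-- A prime not dividing `-150000000000000` (which `2` and `3` divide) is at least `5`.
[cite: BhargavaShankarAnnals2015, Prop. 5.13 (p ≥ 5 with p ∤ Δ)] -/
theorem five_le_of_not_dvd_disc {p : ℕ} (hp : p.Prime) (h : ¬ (p : ℤ) ∣ -150000000000000) : 5 ≤ p := by
  by_contra hlt
  push Not at hlt
  interval_cases p
  · exact absurd hp (by decide)
  · exact absurd hp (by decide)
  · exact h (by norm_num)
  · exact h (by norm_num)
  · exact absurd hp (by decide)

/-- A real point from a positive value: `f(u, z) = v > 0` gives `(u, z, √v)`.
[cite: SilvermanAEC2009, Prop. X.6.5(a) (real points of the homogeneous spaces)] -/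
theorem isSoluble_real_of_pos {d e u z v : ℤ} (huz : u ≠ 0 ∨ z ≠ 0) (hv : 0 < v)
    (hval : d * u ^ 4 + -230 * u ^ 2 * z ^ 2 + e * z ^ 4 = v) :
    ((twoIsogenyQuartic (-230) d e).map (Int.castRingHom ℝ)).IsSoluble := by
  refine ⟨u, z, Real.sqrt v, ?_, ?_⟩
  · rcases huz with h | h
    · exact Or.inl (by exact_mod_cast h)
    · exact Or.inr (by exact_mod_cast h)
  · rw [eval_map_twoIsogenyQuartic, Real.sq_sqrt (by exact_mod_cast hv.le)]
    simp only [eq_intCast]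
    exact_mod_cast hval.symm

/-- A `ℚ_q`-point from a square root in `ℤ_q`: `f(u, z) = c·k²` with `r² = c` gives `(u, z, k r)`.
[cite: SilvermanAEC2009, proof of Prop. X.6.2(b) (local points by lifting square roots)] -/
theorem isSoluble_padic_of_sq {q : ℕ} [Fact q.Prime] {d e u z k c : ℤ} (huz : u ≠ 0 ∨ z ≠ 0)
    (hval : d * u ^ 4 + -230 * u ^ 2 * z ^ 2 + e * z ^ 4 = c * k ^ 2) {r : ℤ_[q]} (hr : r ^ 2 = c) :
    ((twoIsogenyQuartic (-230) d e).map (Int.castRingHom ℚ_[q])).IsSoluble := by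
  refine ⟨u, z, (k : ℚ_[q]) * r, ?_, ?_⟩
  · rcases huz with h | h
    · exact Or.inl (by exact_mod_cast h)
    · exact Or.inr (by exact_mod_cast h)
  · have h := congrArg ((↑) : ℤ_[q] → ℚ_[q]) hr
    push_cast at h
    have hv : ((d * u ^ 4 + -230 * u ^ 2 * z ^ 2 + e * z ^ 4 : ℤ) : ℚ_[q]) = ((c * k ^ 2 : ℤ) : ℚ_[q]) := by
      rw [hval]
    push_cast at hv
    rw [eval_map_twoIsogenyQuartic, mul_pow, h]
    simp only [eq_intCast]
    linear_combination -hv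

/-- Squarefreeness of a (small) integer from the factorisation of its absolute value. [folklore] -/
private theorem squarefree_int_of_natAbs {d : ℤ} {n : ℕ} (h : d.natAbs = n) (hn : n ≠ 0)
    (hnd : n.primeFactorsList.Nodup) : Squarefree d :=
  Int.squarefree_natAbs.mp (h ▸ (Nat.squarefree_iff_nodup_primeFactorsList hn).mpr hnd)

/-! ## The certificates -/

/-- **`C_{-1} : w² = -1u⁴ + -230u²z² + (2400)z⁴` is everywhere locally soluble**: real point `(0, 1)` (value `2400`); `ℚ₂`-point `(1, 1)` (value `1²·(2169)`, `2169 ≡ 1 (mod 8)`); `ℚ_{3}`-point `(1, 1)` (value `3²·(241)`, `≡ 1² (mod 3)`); `ℚ_{5}`-point `(0, 1)` (value `5²·(96)`, `≡ 1² (mod 5)`); good reduction at the other primes.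
[cite: SilvermanAEC2009, Prop. X.6.5(a) (the method: local points by Hensel's lemma)]
[cite: BhargavaShankarAnnals2015, Prop. 5.13 (good reduction implies local solubility)] -/
theorem isLocallySoluble_C_m1 : (twoIsogenyQuartic (-230) (-1) (2400)).IsLocallySoluble := by
  refine ⟨isSoluble_real_of_pos (u := 0) (z := 1) (v := 2400) (Or.inr (by norm_num)) (by norm_num) (by norm_num),
    fun p hp => ?_⟩
  have hP : p.Prime := hp.out
  by_cases hdvd : (p : ℤ) ∣ -150000000000000
  · rcases prime_dvd_disc_cases hP hdvd with rfl | rfl | rfl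
    · obtain ⟨r, hr⟩ := Curve346.exists_sq_eq_two (c := 2169) (by decide)
      exact isSoluble_padic_of_sq (u := 1) (z := 1) (k := 1) (Or.inl (by norm_num)) (by norm_num) hr
    · obtain ⟨r, hr⟩ := exists_sq_eq_intCast (q := 3) (by norm_num) (c := 241) (w := 1) (by norm_num) (by norm_num)
      exact isSoluble_padic_of_sq (u := 1) (z := 1) (k := 3) (Or.inl (by norm_num)) (by norm_num) hr
    · obtain ⟨r, hr⟩ := exists_sq_eq_intCast (q := 5) (by norm_num) (c := 96) (w := 1) (by norm_num) (by norm_num)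
      exact isSoluble_padic_of_sq (u := 0) (z := 1) (k := 5) (Or.inr (by norm_num)) (by norm_num) hr
  · exact BinaryQuartic.isSoluble_padic_of_not_dvd_disc (five_le_of_not_dvd_disc hP hdvd) _
      (by rw [disc_C (-1) (2400) (by norm_num)]; exact hdvd)

/-- **`C_{6} : w² = 6u⁴ + -230u²z² + (-400)z⁴` is everywhere locally soluble**: real point `(1, 0)` (value `6`); `ℚ₂`-point `(1, 1)` (value `4²·(-39)`, `-39 ≡ 1 (mod 8)`); `ℚ_{3}`-point `(1, 4)` (value `3²·(-11786)`, `≡ 1² (mod 3)`); `ℚ_{5}`-point `(0, 1)` (value `5²·(-16)`, `≡ 2² (mod 5)`); good reduction at the other primes.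
[cite: SilvermanAEC2009, Prop. X.6.5(a) (the method: local points by Hensel's lemma)]
[cite: BhargavaShankarAnnals2015, Prop. 5.13 (good reduction implies local solubility)] -/
theorem isLocallySoluble_C_6 : (twoIsogenyQuartic (-230) (6) (-400)).IsLocallySoluble := by
  refine ⟨isSoluble_real_of_pos (u := 1) (z := 0) (v := 6) (Or.inl (by norm_num)) (by norm_num) (by norm_num),
    fun p hp => ?_⟩
  have hP : p.Prime := hp.out
  by_cases hdvd : (p : ℤ) ∣ -150000000000000
  · rcases prime_dvd_disc_cases hP hdvd with rfl | rfl | rfl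
    · obtain ⟨r, hr⟩ := Curve346.exists_sq_eq_two (c := -39) (by decide)
      exact isSoluble_padic_of_sq (u := 1) (z := 1) (k := 4) (Or.inl (by norm_num)) (by norm_num) hr
    · obtain ⟨r, hr⟩ := exists_sq_eq_intCast (q := 3) (by norm_num) (c := -11786) (w := 1) (by norm_num) (by norm_num)
      exact isSoluble_padic_of_sq (u := 1) (z := 4) (k := 3) (Or.inl (by norm_num)) (by norm_num) hr
    · obtain ⟨r, hr⟩ := exists_sq_eq_intCast (q := 5) (by norm_num) (c := -16) (w := 2) (by norm_num) (by norm_num)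
      exact isSoluble_padic_of_sq (u := 0) (z := 1) (k := 5) (Or.inr (by norm_num)) (by norm_num) hr
  · exact BinaryQuartic.isSoluble_padic_of_not_dvd_disc (five_le_of_not_dvd_disc hP hdvd) _
      (by rw [disc_C (6) (-400) (by norm_num)]; exact hdvd)

/-- **`C_{10} : w² = 10u⁴ + -230u²z² + (-240)z⁴` is everywhere locally soluble**: real point `(1, 0)` (value `10`); `ℚ₂`-point `(0, 1)` (value `4²·(-15)`, `-15 ≡ 1 (mod 8)`); `ℚ_{3}`-point `(1, 0)` (value `1²·(10)`, `≡ 1² (mod 3)`); `ℚ_{5}`-point `(3, 4)` (value `125²·(-6)`, `≡ 2² (mod 5)`); good reduction at the other primes.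
[cite: SilvermanAEC2009, Prop. X.6.5(a) (the method: local points by Hensel's lemma)]
[cite: BhargavaShankarAnnals2015, Prop. 5.13 (good reduction implies local solubility)] -/
theorem isLocallySoluble_C_10 : (twoIsogenyQuartic (-230) (10) (-240)).IsLocallySoluble := by
  refine ⟨isSoluble_real_of_pos (u := 1) (z := 0) (v := 10) (Or.inl (by norm_num)) (by norm_num) (by norm_num),
    fun p hp => ?_⟩
  have hP : p.Prime := hp.out
  by_cases hdvd : (p : ℤ) ∣ -150000000000000
  · rcases prime_dvd_disc_cases hP hdvd with rfl | rfl | rfl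
    · obtain ⟨r, hr⟩ := Curve346.exists_sq_eq_two (c := -15) (by decide)
      exact isSoluble_padic_of_sq (u := 0) (z := 1) (k := 4) (Or.inr (by norm_num)) (by norm_num) hr
    · obtain ⟨r, hr⟩ := exists_sq_eq_intCast (q := 3) (by norm_num) (c := 10) (w := 1) (by norm_num) (by norm_num)
      exact isSoluble_padic_of_sq (u := 1) (z := 0) (k := 1) (Or.inl (by norm_num)) (by norm_num) hr
    · obtain ⟨r, hr⟩ := exists_sq_eq_intCast (q := 5) (by norm_num) (c := -6) (w := 2) (by norm_num) (by norm_num)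
      exact isSoluble_padic_of_sq (u := 3) (z := 4) (k := 125) (Or.inl (by norm_num)) (by norm_num) hr
  · exact BinaryQuartic.isSoluble_padic_of_not_dvd_disc (five_le_of_not_dvd_disc hP hdvd) _
      (by rw [disc_C (10) (-240) (by norm_num)]; exact hdvd)

/-- **`C_{-15} : w² = -15u⁴ + -230u²z² + (160)z⁴` is everywhere locally soluble**: real point `(0, 1)` (value `160`); `ℚ₂`-point `(1, 0)` (value `1²·(-15)`, `-15 ≡ 1 (mod 8)`); `ℚ_{3}`-point `(0, 1)` (value `1²·(160)`, `≡ 1² (mod 3)`); `ℚ_{5}`-point `(1, 8)` (value `125²·(41)`, `≡ 1² (mod 5)`); good reduction at the other primes.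
[cite: SilvermanAEC2009, Prop. X.6.5(a) (the method: local points by Hensel's lemma)]
[cite: BhargavaShankarAnnals2015, Prop. 5.13 (good reduction implies local solubility)] -/
theorem isLocallySoluble_C_m15 : (twoIsogenyQuartic (-230) (-15) (160)).IsLocallySoluble := by
  refine ⟨isSoluble_real_of_pos (u := 0) (z := 1) (v := 160) (Or.inr (by norm_num)) (by norm_num) (by norm_num),
    fun p hp => ?_⟩
  have hP : p.Prime := hp.out
  by_cases hdvd : (p : ℤ) ∣ -150000000000000
  · rcases prime_dvd_disc_cases hP hdvd with rfl | rfl | rfl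
    · obtain ⟨r, hr⟩ := Curve346.exists_sq_eq_two (c := -15) (by decide)
      exact isSoluble_padic_of_sq (u := 1) (z := 0) (k := 1) (Or.inl (by norm_num)) (by norm_num) hr
    · obtain ⟨r, hr⟩ := exists_sq_eq_intCast (q := 3) (by norm_num) (c := 160) (w := 1) (by norm_num) (by norm_num)
      exact isSoluble_padic_of_sq (u := 0) (z := 1) (k := 1) (Or.inr (by norm_num)) (by norm_num) hr
    · obtain ⟨r, hr⟩ := exists_sq_eq_intCast (q := 5) (by norm_num) (c := 41) (w := 1) (by norm_num) (by norm_num)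
      exact isSoluble_padic_of_sq (u := 1) (z := 8) (k := 125) (Or.inl (by norm_num)) (by norm_num) hr
  · exact BinaryQuartic.isSoluble_padic_of_not_dvd_disc (five_le_of_not_dvd_disc hP hdvd) _
      (by rw [disc_C (-15) (160) (by norm_num)]; exact hdvd)

/-- **`C_{-6} : w² = -6u⁴ + -230u²z² + (400)z⁴` is everywhere locally soluble**: real point `(0, 1)` (value `400`); `ℚ₂`-point `(0, 1)` (value `4²·(25)`, `25 ≡ 1 (mod 8)`); `ℚ_{3}`-point `(0, 1)` (value `1²·(400)`, `≡ 1² (mod 3)`); `ℚ_{5}`-point `(0, 1)` (value `5²·(16)`, `≡ 1² (mod 5)`); good reduction at the other primes.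
[cite: SilvermanAEC2009, Prop. X.6.5(a) (the method: local points by Hensel's lemma)]
[cite: BhargavaShankarAnnals2015, Prop. 5.13 (good reduction implies local solubility)] -/
theorem isLocallySoluble_C_m6 : (twoIsogenyQuartic (-230) (-6) (400)).IsLocallySoluble := by
  refine ⟨isSoluble_real_of_pos (u := 0) (z := 1) (v := 400) (Or.inr (by norm_num)) (by norm_num) (by norm_num),
    fun p hp => ?_⟩
  have hP : p.Prime := hp.out
  by_cases hdvd : (p : ℤ) ∣ -150000000000000
  · rcases prime_dvd_disc_cases hP hdvd with rfl | rfl | rfl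
    · obtain ⟨r, hr⟩ := Curve346.exists_sq_eq_two (c := 25) (by decide)
      exact isSoluble_padic_of_sq (u := 0) (z := 1) (k := 4) (Or.inr (by norm_num)) (by norm_num) hr
    · obtain ⟨r, hr⟩ := exists_sq_eq_intCast (q := 3) (by norm_num) (c := 400) (w := 1) (by norm_num) (by norm_num)
      exact isSoluble_padic_of_sq (u := 0) (z := 1) (k := 1) (Or.inr (by norm_num)) (by norm_num) hr
    · obtain ⟨r, hr⟩ := exists_sq_eq_intCast (q := 5) (by norm_num) (c := 16) (w := 1) (by norm_num) (by norm_num)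
      exact isSoluble_padic_of_sq (u := 0) (z := 1) (k := 5) (Or.inr (by norm_num)) (by norm_num) hr
  · exact BinaryQuartic.isSoluble_padic_of_not_dvd_disc (five_le_of_not_dvd_disc hP hdvd) _
      (by rw [disc_C (-6) (400) (by norm_num)]; exact hdvd)

/-- **`C_{-10} : w² = -10u⁴ + -230u²z² + (240)z⁴` is everywhere locally soluble**: real point `(0, 1)` (value `240`); `ℚ₂`-point `(4, 1)` (value `4²·(-375)`, `-375 ≡ 1 (mod 8)`); `ℚ_{3}`-point `(1, 8)` (value `3²·(107590)`, `≡ 1² (mod 3)`); `ℚ_{5}`-point `(3, 22)` (value `125²·(3534)`, `≡ 2² (mod 5)`); good reduction at the other primes.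
[cite: SilvermanAEC2009, Prop. X.6.5(a) (the method: local points by Hensel's lemma)]
[cite: BhargavaShankarAnnals2015, Prop. 5.13 (good reduction implies local solubility)] -/
theorem isLocallySoluble_C_m10 : (twoIsogenyQuartic (-230) (-10) (240)).IsLocallySoluble := by
  refine ⟨isSoluble_real_of_pos (u := 0) (z := 1) (v := 240) (Or.inr (by norm_num)) (by norm_num) (by norm_num),
    fun p hp => ?_⟩
  have hP : p.Prime := hp.out
  by_cases hdvd : (p : ℤ) ∣ -150000000000000
  · rcases prime_dvd_disc_cases hP hdvd with rfl | rfl | rfl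
    · obtain ⟨r, hr⟩ := Curve346.exists_sq_eq_two (c := -375) (by decide)
      exact isSoluble_padic_of_sq (u := 4) (z := 1) (k := 4) (Or.inl (by norm_num)) (by norm_num) hr
    · obtain ⟨r, hr⟩ := exists_sq_eq_intCast (q := 3) (by norm_num) (c := 107590) (w := 1) (by norm_num) (by norm_num)
      exact isSoluble_padic_of_sq (u := 1) (z := 8) (k := 3) (Or.inl (by norm_num)) (by norm_num) hr
    · obtain ⟨r, hr⟩ := exists_sq_eq_intCast (q := 5) (by norm_num) (c := 3534) (w := 2) (by norm_num) (by norm_num)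
      exact isSoluble_padic_of_sq (u := 3) (z := 22) (k := 125) (Or.inl (by norm_num)) (by norm_num) hr
  · exact BinaryQuartic.isSoluble_padic_of_not_dvd_disc (five_le_of_not_dvd_disc hP hdvd) _
      (by rw [disc_C (-10) (240) (by norm_num)]; exact hdvd)

/-- **`C_{15} : w² = 15u⁴ + -230u²z² + (-160)z⁴` is everywhere locally soluble**: real point `(1, 0)` (value `15`); `ℚ₂`-point `(1, 1)` (value `1²·(-375)`, `-375 ≡ 1 (mod 8)`); `ℚ_{3}`-point `(5, 1)` (value `3²·(385)`, `≡ 1² (mod 3)`); `ℚ_{5}`-point `(3, 7)` (value `125²·(-31)`, `≡ 2² (mod 5)`); good reduction at the other primes.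
[cite: SilvermanAEC2009, Prop. X.6.5(a) (the method: local points by Hensel's lemma)]
[cite: BhargavaShankarAnnals2015, Prop. 5.13 (good reduction implies local solubility)] -/
theorem isLocallySoluble_C_15 : (twoIsogenyQuartic (-230) (15) (-160)).IsLocallySoluble := by
  refine ⟨isSoluble_real_of_pos (u := 1) (z := 0) (v := 15) (Or.inl (by norm_num)) (by norm_num) (by norm_num),
    fun p hp => ?_⟩
  have hP : p.Prime := hp.out
  by_cases hdvd : (p : ℤ) ∣ -150000000000000
  · rcases prime_dvd_disc_cases hP hdvd with rfl | rfl | rfl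
    · obtain ⟨r, hr⟩ := Curve346.exists_sq_eq_two (c := -375) (by decide)
      exact isSoluble_padic_of_sq (u := 1) (z := 1) (k := 1) (Or.inl (by norm_num)) (by norm_num) hr
    · obtain ⟨r, hr⟩ := exists_sq_eq_intCast (q := 3) (by norm_num) (c := 385) (w := 1) (by norm_num) (by norm_num)
      exact isSoluble_padic_of_sq (u := 5) (z := 1) (k := 3) (Or.inl (by norm_num)) (by norm_num) hr
    · obtain ⟨r, hr⟩ := exists_sq_eq_intCast (q := 5) (by norm_num) (c := -31) (w := 2) (by norm_num) (by norm_num)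
      exact isSoluble_padic_of_sq (u := 3) (z := 7) (k := 125) (Or.inl (by norm_num)) (by norm_num) hr
  · exact BinaryQuartic.isSoluble_padic_of_not_dvd_disc (five_le_of_not_dvd_disc hP hdvd) _
      (by rw [disc_C (15) (-160) (by norm_num)]; exact hdvd)

/-- `-1 ∈ S(-230, -2400)`. [cite: SilvermanAEC2009, Prop. X.4.9] -/
theorem mem_S_m1 : (-1 : ℤ) ∈ twoIsogenySelmerGroup (-230) (-2400) :=
  (mem_twoIsogenySelmerGroup_iff (by norm_num)).mpr
    ⟨squarefree_int_of_natAbs (n := 1) rfl (by norm_num) (by simp), by norm_num,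
      by rw [show (-2400 : ℤ) / -1 = 2400 by norm_num]; exact isLocallySoluble_C_m1⟩

/-- `6 ∈ S(-230, -2400)`. [cite: SilvermanAEC2009, Prop. X.4.9] -/
theorem mem_S_6 : (6 : ℤ) ∈ twoIsogenySelmerGroup (-230) (-2400) :=
  (mem_twoIsogenySelmerGroup_iff (by norm_num)).mpr
    ⟨squarefree_int_of_natAbs (n := 6) rfl (by norm_num) (by simp), by norm_num,
      by rw [show (-2400 : ℤ) / 6 = -400 by norm_num]; exact isLocallySoluble_C_6⟩

/-- `10 ∈ S(-230, -2400)`. [cite: SilvermanAEC2009, Prop. X.4.9] -/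
theorem mem_S_10 : (10 : ℤ) ∈ twoIsogenySelmerGroup (-230) (-2400) :=
  (mem_twoIsogenySelmerGroup_iff (by norm_num)).mpr
    ⟨squarefree_int_of_natAbs (n := 10) rfl (by norm_num) (by simp), by norm_num,
      by rw [show (-2400 : ℤ) / 10 = -240 by norm_num]; exact isLocallySoluble_C_10⟩

/-- `-15 ∈ S(-230, -2400)`. [cite: SilvermanAEC2009, Prop. X.4.9] -/
theorem mem_S_m15 : (-15 : ℤ) ∈ twoIsogenySelmerGroup (-230) (-2400) :=
  (mem_twoIsogenySelmerGroup_iff (by norm_num)).mpr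
    ⟨squarefree_int_of_natAbs (n := 15) rfl (by norm_num) (by simp), by norm_num,
      by rw [show (-2400 : ℤ) / -15 = 160 by norm_num]; exact isLocallySoluble_C_m15⟩

/-- `-6 ∈ S(-230, -2400)`. [cite: SilvermanAEC2009, Prop. X.4.9] -/
theorem mem_S_m6 : (-6 : ℤ) ∈ twoIsogenySelmerGroup (-230) (-2400) :=
  (mem_twoIsogenySelmerGroup_iff (by norm_num)).mpr
    ⟨squarefree_int_of_natAbs (n := 6) rfl (by norm_num) (by simp), by norm_num,
      by rw [show (-2400 : ℤ) / -6 = 400 by norm_num]; exact isLocallySoluble_C_m6⟩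

/-- `-10 ∈ S(-230, -2400)`. [cite: SilvermanAEC2009, Prop. X.4.9] -/
theorem mem_S_m10 : (-10 : ℤ) ∈ twoIsogenySelmerGroup (-230) (-2400) :=
  (mem_twoIsogenySelmerGroup_iff (by norm_num)).mpr
    ⟨squarefree_int_of_natAbs (n := 10) rfl (by norm_num) (by simp), by norm_num,
      by rw [show (-2400 : ℤ) / -10 = 240 by norm_num]; exact isLocallySoluble_C_m10⟩

/-- `15 ∈ S(-230, -2400)`. [cite: SilvermanAEC2009, Prop. X.4.9] -/
theorem mem_S_15 : (15 : ℤ) ∈ twoIsogenySelmerGroup (-230) (-2400) :=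
  (mem_twoIsogenySelmerGroup_iff (by norm_num)).mpr
    ⟨squarefree_int_of_natAbs (n := 15) rfl (by norm_num) (by simp), by norm_num,
      by rw [show (-2400 : ℤ) / 15 = -160 by norm_num]; exact isLocallySoluble_C_15⟩

end Curve2000

end Literature.NumberTheory.EllipticCurves

end
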